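import Summits.QuantumFields.BalabanUV.T4Continuum.Spine.NE2.DeltaPrimeSecondOrder
import Summits.QuantumFields.BalabanUV.T4Continuum.Spine.NE2BalabanHodgeShift

/-!
# T⁴ programme, spine node NE2 (U1a) — THE `Δ′` FIELD HYPOTHESES IN PRINT'S CURRENCY, AND THE RATE END WITH NOTHING BUT (3.35)/(3.36)/NE3-SHAPED DATA
# (repair R13, closing file: the edge half of the feed discharged; dictionary B0's residual r1 fully reduced to node NE3's currency)

Cell `pub-balaban-gaps` (track G2, seat ne2 = spine estimate NE2; census `run/shared/lean/pub/pub-balaban-gaps/ne/NE2.md` §5 R13, §10).  The rate ENDs of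
`Spine/NE2/DeltaPrimeSecondOrder` (`balaban_hodge_deltaPrime_rate`, `principalB9_deltaPrime_rate_of_regular`) display `BoundedBackgroundM` of the three explicit
plaquette-field towers `zS`, `zF`, `zB` of (3.10)'s `Δ′`; `DeltaPrimeSecondOrder.boundedBackgroundM_zS` and `DeltaPrimeHodgeRate.boundedBackgroundM_zF/zB` reduce
them to size + SHIFTED block-parent consistency of the three factors (edge matrix, plaquette field, edge matrix).  THIS FILE removes the edge factors from the
hypotheses altogether: **`norm_edgeR_sub_edgeR_le`** — if the bond variables of `V`, `V′` are within `s`, `s′` of `1`, every signed edge matrix of `V′` (at any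
base point, on any lattice) differs from that of `V` by at most `2(s′ + s)`, transposes included (`norm_adM_sub_adM_le` ⇐ `AdjointFieldInstance.norm_adRep_sub_adRep_le`
+ real entries); so along a tower with `‖V_k − 1‖ ≤ α₁/L^k` — the (3.35) size shape in lattice units — the shifted consistency of the edge factors holds with
constant `4α₁` FOR FREE (**`edge_consistent`**; no smoothness involved).  Hence **`boundedBackgroundM_zS_of_small`**, **`boundedBackgroundM_zF_of_small`**,
**`boundedBackgroundM_zB_of_small`**: `BoundedBackgroundM` of the `Δ′` field towers from (i) unitarity and `‖V_k − 1‖ ≤ α₁/L^k`, (ii) size `≤ b` of the plaquette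
field (`S_k = symF(c_k²(Re U_k(∂p) − 1))`, resp. `B_k = brkF(c_k² Im U_k(∂p))`; the (3.35) shape), (iii) its block-parent consistency `σ/L^k` (node NE3's shape) and
(iv) its lattice-Lipschitz bound `σ′/L^k` (the (3.36) shape) — via `DeltaPrimeCatalogue.shifted_consistent`.  And the END **`principalB9_deltaPrime_rate_of_small`**:
  `TowerLimitRate (Qlev ⊗ 1) L^d (k ↦ (principalB9 (Ad V_k) (P_k) + a·Q*Q ⊗ 1 + avgPert(Ad V) k + Δ′(V_k))⁻¹) (Cpert (κ_H + κ_{Δ′}) (2dCst) CJ (…) 0 1) L⁻¹`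
under: `RegularSites (Ad ∘ V) α β β₂` ((3.35)–(3.36) shapes of the connection), node NE3's `LocalRate` on `regClass₂ (Ad ∘ V)` BY NAME (OPEN), `α, β ≤ η ≤ etaStar ι d a a′`,
the seven data bounds (i)–(iv) above, and ONE threshold `κ_H + kappaDP d a b_S b_B < 1` — NOTHING ELSE (the mixed-shift `ShiftLaws` binder of the earlier ENDs is
DISCHARGED here by `NE2BalabanHodgeShift.shiftLaws_mixedShift`): every
hypothesis about `Δ′` is now a size / consistency / Lipschitz statement about the bond variables and the two plaquette fields of the DATA `V`, i.e. in the
currency node NE3 and rows (3.35)–(3.36) trade in.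
HONEST FRAMING (T4-DAG p. 1).  Composition BY NAME at MODEL LEVEL (`V`, `e`, `c` DATA; hypothesis structures displayed; nothing printed is a hypothesis or a
conclusion); NOT asserted: that `V` is Bałaban's minimiser or that the displayed bounds hold for it (node NE3, OPEN; (3.35)–(3.36) are Bałaban's theorems about the
minimiser, not formalised), the [B7] averaging (residual r2), m = k layer uniformity beyond the tree's `TowerLimitRate` currency; NE2 (U1a) NOT PROVED; spine
PROVED 0/9 unchanged; NOT continuum YM / infinite volume / mass gap / Clay.  HONEST DEPENDENCY: continuum YM on T⁴ ⇐ BetaPertH ∧ nine spine estimates (0/9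
proved); BetaPertH ⇐ (D1) ∧ (D4) ∧ CAP+tail; G-an2-4 gates asym, D1 and NE2/3/4.  No `sorry`, no `def`.
-/

noncomputable section

open scoped BigOperators ComplexConjugate Matrix




namespace Summit.QuantumFields.BalabanUV.T4Continuum.NE2.DeltaPrimeData

open scoped Kronecker Matrix.Norms.L2Operator
open Literature.MathematicalPhysics.QuantumFieldTheory.Balaban1983to89.B5Prop11Plancherel (Tor fine shiftM unitVec Cst Cst_nonneg)
open Literature.MathematicalPhysics.QuantumFieldTheory.Balaban1983to89.B5G183RateUnitTower (lev lev_neZero)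
open Literature.MathematicalPhysics.QuantumFieldTheory.Balaban1983to89.T4EtaRateMin (LocalRate)
open Literature.MathematicalPhysics.QuantumFieldTheory.Balaban1983to89.B5Block118 (QvOp)
open Literature.MathematicalPhysics.QuantumFieldTheory.Balaban1983to89.B5DeltaA169 (QvAdj)
open Summit.QuantumFields.BalabanUV.T4Continuum
open Summit.QuantumFields.BalabanUV.T4Continuum.BalabanAveragedTowerUnit (idx Qlev one_le_lev' lev_succ')
open Summit.QuantumFields.BalabanUV.T4Continuum.BalabanAveragedTowerModes (par)
open Summit.QuantumFields.BalabanUV.T4Continuum.CovariantAveragingTower (TowerLimitRate)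
open Summit.QuantumFields.BalabanUV.T4Continuum.BackgroundResolventTower (Cpert)
open Summit.QuantumFields.BalabanUV.T4Continuum.KingPairingPlantedLaw (CJ)
open Summit.QuantumFields.BalabanUV.T4Continuum.ColourCovariantLaplacian (BoundedBackgroundM)
open Summit.QuantumFields.BalabanUV.T4Continuum.NE2FromNE3 (bgReadings)
open Summit.QuantumFields.BalabanUV.T4Continuum.RegularBackgroundTower (betaNE3)
open Summit.QuantumFields.BalabanUV.T4Continuum.ShiftedZerothOrder (ShiftLaws)
open Summit.QuantumFields.BalabanUV.T4Continuum.HolonomyTowerRegular (RegularSites regClass₂)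
open Summit.QuantumFields.BalabanUV.T4Continuum.GaugeTermScalarData (QuT Q1)
open Summit.QuantumFields.BalabanUV.T4Continuum.RegularSiteTransporters (siteT)
open Summit.QuantumFields.BalabanUV.T4Continuum.NestedContourTransport (theta0)
open Summit.QuantumFields.BalabanUV.T4Continuum.GramPerturbationLaw (C2gram)
open Summit.QuantumFields.BalabanUV.T4Continuum.NE2BalabanRoot (avgPert)
open Summit.QuantumFields.BalabanUV.T4Continuum.NE2BalabanGauge (liftR)
open Summit.QuantumFields.BalabanUV.T4Continuum.NE2BalabanLayerSharp (kappaBs C2Bs)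
open Summit.QuantumFields.BalabanUV.T4Continuum.NE2BalabanWiring (epsR CdeltaR)
open Summit.QuantumFields.BalabanUV.T4Continuum.NE2BalabanFinal (kappa4F C4F)
open Summit.QuantumFields.BalabanUV.T4Continuum.NE2BalabanThreshold (etaStar)
open Summit.QuantumFields.BalabanUV.T4Continuum.NE2BalabanHodgeShift (shiftLaws_mixedShift)
open Summit.QuantumFields.BalabanUV.T4Continuum.GaugeTermSandwichBound (projP)
open Summit.QuantumFields.BalabanUV.T4Continuum.GaugeTermLayer (Gop)
open Summit.QuantumFields.BalabanUV.Beta.AdjointCarrierWiring (adMat)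
open Summit.QuantumFields.BalabanUV.Beta.AdjointCarrierWiringEnd (CompFamily)
open Summit.QuantumFields.BalabanUV.Beta.ThinLoopHolonomy (cpxHom conjTranspose_cpxHom)
open Summit.QuantumFields.BalabanUV.T4Continuum.NE2.AdjointFieldInstance (adRep adRep_apply norm_adRep_sub_adRep_le)
open Summit.QuantumFields.BalabanUV.T4Continuum.NE2.DeltaPrimeOperator
open Summit.QuantumFields.BalabanUV.T4Continuum.NE2.DeltaPrimeCatalogue
open Summit.QuantumFields.BalabanUV.T4Continuum.NE2.DictionaryB0 (principalB9)
open Summit.QuantumFields.BalabanUV.T4Continuum.NE2.DeltaPrimeSecondOrder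

variable {n : Type} [Fintype n] [DecidableEq n] {d : ℕ} {ι : Type} [Fintype ι] [DecidableEq ι]

/-! ## §1 Consistency of the signed edge matrices from closeness of the bond variables to `1` -/

section Edge

variable {c : ℝ} {e : ι → Matrix n n ℂ} {Pc : Submodule ℝ (Matrix n n ℂ)}

include Pc in
/-- the adjoint colour matrices of two unitaries differ by at most twice the sum of their distances to `1`; the same for the transposes (real entries). [folklore] -/
theorem norm_adM_sub_adM_le [Nonempty n] (hF : CompFamily c Pc e) {u u' : Matrix n n ℂ} (hu : u ∈ Matrix.unitaryGroup n ℂ) (hu' : u' ∈ Matrix.unitaryGroup n ℂ) :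
    ‖(adMat c e u').map ((↑) : ℝ → ℂ) - (adMat c e u).map ((↑) : ℝ → ℂ)‖ ≤ 2 * (‖u' - 1‖ + ‖u - 1‖)
      ∧ ‖((adMat c e u').map ((↑) : ℝ → ℂ))ᵀ - ((adMat c e u).map ((↑) : ℝ → ℂ))ᵀ‖ ≤ 2 * (‖u' - 1‖ + ‖u - 1‖) := by
  have h1 : ‖(adMat c e u').map ((↑) : ℝ → ℂ) - (adMat c e u).map ((↑) : ℝ → ℂ)‖ ≤ 2 * (‖u' - 1‖ + ‖u - 1‖) := by
    have h := norm_adRep_sub_adRep_le hF ⟨u', hu'⟩ ⟨u, hu⟩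
    rw [adRep_apply, adRep_apply] at h
    calc ‖(adMat c e u').map ((↑) : ℝ → ℂ) - (adMat c e u).map ((↑) : ℝ → ℂ)‖ ≤ 2 * ‖u' - u‖ := h
      _ ≤ 2 * (‖u' - 1‖ + ‖u - 1‖) := by
          have : ‖u' - u‖ ≤ ‖u' - 1‖ + ‖u - 1‖ := by
            calc ‖u' - u‖ = ‖(u' - 1) - (u - 1)‖ := by rw [sub_sub_sub_cancel_right]
              _ ≤ ‖u' - 1‖ + ‖u - 1‖ := norm_sub_le _ _
          linarith
  refine ⟨h1, ?_⟩
  have hT : ∀ X : Matrix ι ι ℝ, (X.map ((↑) : ℝ → ℂ))ᵀ = (X.map ((↑) : ℝ → ℂ))ᴴ := by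
    intro X; ext k l; simp [Matrix.conjTranspose_apply, Matrix.transpose_apply]
  rw [hT, hT, ← Matrix.conjTranspose_sub, Matrix.l2_opNorm_conjTranspose]
  exact h1

include Pc in
/-- **CONSISTENCY OF THE EDGE MATRICES FROM SIZE ALONE**: if all bond variables of `V` (resp. `V′`) are within `s` (resp. `s′`) of `1`, then every signed edge matrix
of `V′` at any base point differs from that of `V` at any base point by at most `2(s′ + s)`, and likewise for the transposes.  (Both transporters are close
to `1`; no smoothness is involved — this is why the edge factors of the `Δ′` fields cost nothing beyond the (3.35) size bound.) [folklore] -/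
theorem norm_edgeR_sub_edgeR_le [Nonempty n] [Nonempty ι] (hF : CompFamily c Pc e) {N N' : Fin d → ℕ} [∀ μ, NeZero (N μ)] [∀ μ, NeZero (N' μ)]
    {V : Fin d → Tor N → Matrix n n ℂ} {V' : Fin d → Tor N' → Matrix n n ℂ}
    (hV : ∀ μ x, V μ x ∈ Matrix.unitaryGroup n ℂ) (hV' : ∀ μ y, V' μ y ∈ Matrix.unitaryGroup n ℂ) {s s' : ℝ}
    (h1 : ∀ μ x, ‖V μ x - 1‖ ≤ s) (h1' : ∀ μ y, ‖V' μ y - 1‖ ≤ s') (x : Tor N) (y : Tor N') (μ ν : Fin d) (j : Fin 4) :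
    ‖edgeR N' c e V' y μ ν j - edgeR N c e V x μ ν j‖ ≤ 2 * (s' + s)
      ∧ ‖(edgeR N' c e V' y μ ν j)ᵀ - (edgeR N c e V x μ ν j)ᵀ‖ ≤ 2 * (s' + s) := by
  have hs : 0 ≤ s := (norm_nonneg _).trans (h1 μ x)
  have hs' : 0 ≤ s' := (norm_nonneg _).trans (h1' μ y)
  have h0 : (0 : ℝ) ≤ 2 * (s' + s) := by positivity
  have key : ∀ lam, ‖(adMat c e (V' lam y)).map ((↑) : ℝ → ℂ) - (adMat c e (V lam x)).map ((↑) : ℝ → ℂ)‖ ≤ 2 * (s' + s)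
      ∧ ‖((adMat c e (V' lam y)).map ((↑) : ℝ → ℂ))ᵀ - ((adMat c e (V lam x)).map ((↑) : ℝ → ℂ))ᵀ‖ ≤ 2 * (s' + s) := by
    intro lam
    obtain ⟨a, b⟩ := norm_adM_sub_adM_le hF (hV lam x) (hV' lam y)
    have hm : 2 * (‖V' lam y - 1‖ + ‖V lam x - 1‖) ≤ 2 * (s' + s) := by linarith [h1 lam x, h1' lam y]
    exact ⟨a.trans hm, b.trans hm⟩
  fin_cases j
  · obtain ⟨a, b⟩ := key ν
    refine ⟨?_, ?_⟩
    · show ‖-(adMat c e (V' ν y)).map ((↑) : ℝ → ℂ) - -(adMat c e (V ν x)).map ((↑) : ℝ → ℂ)‖ ≤ 2 * (s' + s)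
      rw [neg_sub_neg, norm_sub_rev]; exact a
    · show ‖(-(adMat c e (V' ν y)).map ((↑) : ℝ → ℂ))ᵀ - (-(adMat c e (V ν x)).map ((↑) : ℝ → ℂ))ᵀ‖ ≤ 2 * (s' + s)
      rw [Matrix.transpose_neg, Matrix.transpose_neg, neg_sub_neg, norm_sub_rev]; exact b
  · refine ⟨?_, ?_⟩
    · show ‖(-1 : Matrix ι ι ℂ) - (-1)‖ ≤ 2 * (s' + s)
      rw [sub_self, norm_zero]; exact h0
    · show ‖(-1 : Matrix ι ι ℂ)ᵀ - (-1 : Matrix ι ι ℂ)ᵀ‖ ≤ 2 * (s' + s)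
      rw [sub_self, norm_zero]; exact h0
  · refine ⟨?_, ?_⟩
    · show ‖(1 : Matrix ι ι ℂ) - 1‖ ≤ 2 * (s' + s)
      rw [sub_self, norm_zero]; exact h0
    · show ‖(1 : Matrix ι ι ℂ)ᵀ - (1 : Matrix ι ι ℂ)ᵀ‖ ≤ 2 * (s' + s)
      rw [sub_self, norm_zero]; exact h0
  · exact key μ

end Edge

/-! ## §2 The `Δ′` field hypotheses from data in print's currency: size of `V − 1`, and size / consistency / lattice-Lipschitz of the plaquette fields -/

section Feed

variable (L : ℕ) [NeZero L] (M : Fin d → ℕ) [hM : ∀ μ, NeZero (M μ)] {c : ℝ} {e : ι → Matrix n n ℂ} {Pc : Submodule ℝ (Matrix n n ℂ)}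

omit hM in
/-- `α₁/L^{k+1} ≤ α₁/L^k`. [folklore] -/
theorem div_lev_succ_le {α₁ : ℝ} (hα₁ : 0 ≤ α₁) (k : ℕ) : α₁ / (lev L (k + 1) : ℕ) ≤ α₁ / (lev L k : ℕ) := by
  have hk : (0 : ℝ) < (lev L k : ℕ) := by exact_mod_cast one_le_lev' L k
  have hle : ((lev L k : ℕ) : ℝ) ≤ ((lev L (k + 1) : ℕ) : ℝ) := by
    rw [lev_succ']
    exact_mod_cast Nat.le_mul_of_pos_left _ (Nat.pos_of_ne_zero (NeZero.ne L))
  exact div_le_div_of_nonneg_left hα₁ hk hle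

include Pc in
/-- **THE EDGE HALF OF THE FEED, DISCHARGED**: for a unitary bond-field tower with `‖V_k − 1‖ ≤ α₁/L^k` (the (3.35) size shape in lattice units), the shifted
block-parent consistency of every edge factor (and of its transpose) holds with constant `4α₁`. [folklore] -/
theorem edge_consistent [Nonempty n] [Nonempty ι] (hF : CompFamily c Pc e) (V : (k : ℕ) → Fin d → Tor (fine (lev L k) M) → Matrix.unitaryGroup n ℂ)
    {α₁ : ℝ} (hα₁ : 0 ≤ α₁) (hV1 : ∀ k μ x, ‖(V k μ x : Matrix n n ℂ) - 1‖ ≤ α₁ / (lev L k : ℕ)) (μ ν : Fin d) (j j' : Fin 4) (k : ℕ)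
    (y : Tor (fine (lev L (k + 1)) M)) :
    ‖edgeR (fine (lev L (k + 1)) M) c e (fun ν x => (V (k + 1) ν x : Matrix n n ℂ)) (y - edgeOff (fine (lev L (k + 1)) M) μ ν j) μ ν j'
        - edgeR (fine (lev L k) M) c e (fun ν x => (V k ν x : Matrix n n ℂ)) (par (lev L k) L M y - edgeOff (fine (lev L k) M) μ ν j) μ ν j'‖
          ≤ 4 * α₁ / (lev L k : ℕ)
      ∧ ‖(edgeR (fine (lev L (k + 1)) M) c e (fun ν x => (V (k + 1) ν x : Matrix n n ℂ)) (y - edgeOff (fine (lev L (k + 1)) M) μ ν j) μ ν j')ᵀ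
        - (edgeR (fine (lev L k) M) c e (fun ν x => (V k ν x : Matrix n n ℂ)) (par (lev L k) L M y - edgeOff (fine (lev L k) M) μ ν j) μ ν j')ᵀ‖
          ≤ 4 * α₁ / (lev L k : ℕ) := by
  have h := norm_edgeR_sub_edgeR_le hF
    (V := fun ν x => (V k ν x : Matrix n n ℂ)) (V' := fun ν x => (V (k + 1) ν x : Matrix n n ℂ))
    (fun μ x => (V k μ x).2) (fun μ y => (V (k + 1) μ y).2) (fun μ x => hV1 k μ x) (fun μ y => (hV1 (k + 1) μ y).trans (div_lev_succ_le L hα₁ k))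
    (par (lev L k) L M y - edgeOff (fine (lev L k) M) μ ν j) (y - edgeOff (fine (lev L (k + 1)) M) μ ν j) μ ν j'
  have he : 2 * (α₁ / (lev L k : ℕ) + α₁ / (lev L k : ℕ)) = 4 * α₁ / (lev L k : ℕ) := by ring
  rw [he] at h
  exact h

include Pc in
/-- **FEED FOR `zS` IN PRINT'S CURRENCY**: unitary `V` with `‖V_k − 1‖ ≤ α₁/L^k`; the plaquette field `S_k = symF(c_k²(Re U_k(∂p) − 1))` of size `≤ b` ((3.35) shape),
block-parent consistent (`σ/L^k`, node NE3's shape) and lattice-Lipschitz (`σ′/L^k`, (3.36) shape) ⟹ `BoundedBackgroundM` of `zS`. [folklore] -/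
theorem boundedBackgroundM_zS_of_small [Nonempty n] [Nonempty ι] (hF : CompFamily c Pc e)
    (V : (k : ℕ) → Fin d → Tor (fine (lev L k) M) → Matrix.unitaryGroup n ℂ) {α₁ b σ σ' : ℝ} (hα₁ : 0 ≤ α₁) (hb : 0 ≤ b) (hσ : 0 ≤ σ) (hσ' : 0 ≤ σ')
    (hV1 : ∀ k μ x, ‖(V k μ x : Matrix n n ℂ) - 1‖ ≤ α₁ / (lev L k : ℕ))
    (hSb : ∀ k μ ν x, ‖Sfield (fine (lev L k) M) (lev L k) c e (fun ν x => (V k ν x : Matrix n n ℂ)) μ ν x‖ ≤ b)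
    (hSc : ∀ k μ ν (y : Tor (fine (lev L (k + 1)) M)), ‖Sfield (fine (lev L (k + 1)) M) (lev L (k + 1)) c e (fun ν x => (V (k + 1) ν x : Matrix n n ℂ)) μ ν y
      - Sfield (fine (lev L k) M) (lev L k) c e (fun ν x => (V k ν x : Matrix n n ℂ)) μ ν (par (lev L k) L M y)‖ ≤ σ / (lev L k : ℕ))
    (hSl : ∀ k μ ν lam (x : Tor (fine (lev L k) M)), ‖Sfield (fine (lev L k) M) (lev L k) c e (fun ν x => (V k ν x : Matrix n n ℂ)) μ ν (x - unitVec _ lam)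
      - Sfield (fine (lev L k) M) (lev L k) c e (fun ν x => (V k ν x : Matrix n n ℂ)) μ ν x‖ ≤ σ' / (lev L k : ℕ))
    (μ ν : Fin d) (jj : Fin 4 × Fin 4) :
    BoundedBackgroundM L M (zS L M c e (fun k ν x => (V k ν x : Matrix n n ℂ)) μ ν jj) b (b * (4 * α₁) + (σ + σ') + b * (4 * α₁)) := by
  refine boundedBackgroundM_zS L M c e (fun k ν x => (V k ν x : Matrix n n ℂ)) μ ν jj hb (by positivity) (by positivity) (by positivity)
    (fun k x => (norm_edgeR_le_one _ hF (fun μ x => (V k μ x).2) x μ ν jj.1).2)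
    (fun k x => (norm_edgeR_le_one _ hF (fun μ x => (V k μ x).2) x μ ν jj.2).1)
    (fun k x => hSb k μ ν x) (fun k y => ?_) (fun k y => ?_) (fun k y => ?_)
  · have := (edge_consistent L M hF V hα₁ hV1 μ ν jj.1 jj.1 k y).2
    exact this
  · exact shifted_consistent L M (X := fun k x => Sfield (fine (lev L k) M) (lev L k) c e (fun ν x => (V k ν x : Matrix n n ℂ)) μ ν x) hσ'
      (fun k y => hSc k μ ν y) (fun k lam x => hSl k μ ν lam x) μ ν jj.1 k y
  · have := (edge_consistent L M hF V hα₁ hV1 μ ν jj.1 jj.2 k y).1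
    exact this

include Pc in
/-- **FEED FOR `zF` IN PRINT'S CURRENCY** (the plaquette field `B_k = brkF(c_k² Im U_k(∂p))`). [folklore] -/
theorem boundedBackgroundM_zF_of_small [Nonempty n] [Nonempty ι] (hF : CompFamily c Pc e)
    (V : (k : ℕ) → Fin d → Tor (fine (lev L k) M) → Matrix.unitaryGroup n ℂ) {α₁ b σ σ' : ℝ} (hα₁ : 0 ≤ α₁) (hb : 0 ≤ b) (hσ : 0 ≤ σ) (hσ' : 0 ≤ σ')
    (hV1 : ∀ k μ x, ‖(V k μ x : Matrix n n ℂ) - 1‖ ≤ α₁ / (lev L k : ℕ))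
    (hBb : ∀ k μ ν x, ‖Bfield (fine (lev L k) M) (lev L k) c e (fun ν x => (V k ν x : Matrix n n ℂ)) μ ν x‖ ≤ b)
    (hBc : ∀ k μ ν (y : Tor (fine (lev L (k + 1)) M)), ‖Bfield (fine (lev L (k + 1)) M) (lev L (k + 1)) c e (fun ν x => (V (k + 1) ν x : Matrix n n ℂ)) μ ν y
      - Bfield (fine (lev L k) M) (lev L k) c e (fun ν x => (V k ν x : Matrix n n ℂ)) μ ν (par (lev L k) L M y)‖ ≤ σ / (lev L k : ℕ))
    (hBl : ∀ k μ ν lam (x : Tor (fine (lev L k) M)), ‖Bfield (fine (lev L k) M) (lev L k) c e (fun ν x => (V k ν x : Matrix n n ℂ)) μ ν (x - unitVec _ lam)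
      - Bfield (fine (lev L k) M) (lev L k) c e (fun ν x => (V k ν x : Matrix n n ℂ)) μ ν x‖ ≤ σ' / (lev L k : ℕ))
    (μ ν : Fin d) (jj : Fin 4 × Fin 4) :
    BoundedBackgroundM L M (zF L M c e (fun k ν x => (V k ν x : Matrix n n ℂ)) μ ν jj) b (b * (4 * α₁) + (σ + σ') + b * (4 * α₁)) := by
  refine boundedBackgroundM_zF L M c e (fun k ν x => (V k ν x : Matrix n n ℂ)) μ ν jj hb (by positivity) (by positivity) (by positivity)
    (fun k x => (norm_edgeR_le_one _ hF (fun μ x => (V k μ x).2) x μ ν jj.1).2)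
    (fun k x => (norm_edgeR_le_one _ hF (fun μ x => (V k μ x).2) x μ ν jj.2).1)
    (fun k x => hBb k μ ν x) (fun k y => ?_) (fun k y => ?_) (fun k y => ?_)
  · have := (edge_consistent L M hF V hα₁ hV1 μ ν jj.1 jj.1 k y).2
    exact this
  · exact shifted_consistent L M (X := fun k x => Bfield (fine (lev L k) M) (lev L k) c e (fun ν x => (V k ν x : Matrix n n ℂ)) μ ν x) hσ'
      (fun k y => hBc k μ ν y) (fun k lam x => hBl k μ ν lam x) μ ν jj.1 k y
  · have := (edge_consistent L M hF V hα₁ hV1 μ ν jj.1 jj.2 k y).1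
    exact this

include Pc in
/-- **FEED FOR `zB` IN PRINT'S CURRENCY** (the transposed partner: `Bᵀ = −B` by `brkF_transpose`). [folklore] -/
theorem boundedBackgroundM_zB_of_small [Nonempty n] [Nonempty ι] (hF : CompFamily c Pc e)
    (V : (k : ℕ) → Fin d → Tor (fine (lev L k) M) → Matrix.unitaryGroup n ℂ) {α₁ b σ σ' : ℝ} (hα₁ : 0 ≤ α₁) (hb : 0 ≤ b) (hσ : 0 ≤ σ) (hσ' : 0 ≤ σ')
    (hV1 : ∀ k μ x, ‖(V k μ x : Matrix n n ℂ) - 1‖ ≤ α₁ / (lev L k : ℕ))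
    (hBb : ∀ k μ ν x, ‖Bfield (fine (lev L k) M) (lev L k) c e (fun ν x => (V k ν x : Matrix n n ℂ)) μ ν x‖ ≤ b)
    (hBc : ∀ k μ ν (y : Tor (fine (lev L (k + 1)) M)), ‖Bfield (fine (lev L (k + 1)) M) (lev L (k + 1)) c e (fun ν x => (V (k + 1) ν x : Matrix n n ℂ)) μ ν y
      - Bfield (fine (lev L k) M) (lev L k) c e (fun ν x => (V k ν x : Matrix n n ℂ)) μ ν (par (lev L k) L M y)‖ ≤ σ / (lev L k : ℕ))
    (hBl : ∀ k μ ν lam (x : Tor (fine (lev L k) M)), ‖Bfield (fine (lev L k) M) (lev L k) c e (fun ν x => (V k ν x : Matrix n n ℂ)) μ ν (x - unitVec _ lam)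
      - Bfield (fine (lev L k) M) (lev L k) c e (fun ν x => (V k ν x : Matrix n n ℂ)) μ ν x‖ ≤ σ' / (lev L k : ℕ))
    (μ ν : Fin d) (jj : Fin 4 × Fin 4) :
    BoundedBackgroundM L M (zB L M c e (fun k ν x => (V k ν x : Matrix n n ℂ)) μ ν jj) b (b * (4 * α₁) + (σ + σ') + b * (4 * α₁)) := by
  have hT : ∀ k (x : Tor (fine (lev L k) M)), (Bfield (fine (lev L k) M) (lev L k) c e (fun ν x => (V k ν x : Matrix n n ℂ)) μ ν x)ᵀ
      = -Bfield (fine (lev L k) M) (lev L k) c e (fun ν x => (V k ν x : Matrix n n ℂ)) μ ν x := fun k x => by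
    rw [Bfield, brkF_transpose]
  refine boundedBackgroundM_zB L M c e (fun k ν x => (V k ν x : Matrix n n ℂ)) μ ν jj hb (by positivity) (by positivity) (by positivity)
    (fun k x => (norm_edgeR_le_one _ hF (fun μ x => (V k μ x).2) x μ ν jj.2).2)
    (fun k x => (norm_edgeR_le_one _ hF (fun μ x => (V k μ x).2) x μ ν jj.1).1)
    (fun k x => by rw [hT, norm_neg]; exact hBb k μ ν x) (fun k y => ?_) (fun k y => ?_) (fun k y => ?_)
  · have := (edge_consistent L M hF V hα₁ hV1 μ ν jj.2 jj.2 k y).2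
    exact this
  · rw [hT, hT, neg_sub_neg, norm_sub_rev]
    exact shifted_consistent L M (X := fun k x => Bfield (fine (lev L k) M) (lev L k) c e (fun ν x => (V k ν x : Matrix n n ℂ)) μ ν x) hσ'
      (fun k y => hBc k μ ν y) (fun k lam x => hBl k μ ν lam x) μ ν jj.2 k y
  · have := (edge_consistent L M hF V hα₁ hV1 μ ν jj.2 jj.1 k y).1
    exact this

end Feed

/-! ## §3 The rate END with every `Δ′` hypothesis in print's currency -/

section Rate

variable (L : ℕ) [NeZero L] (M : Fin d → ℕ) [hM : ∀ μ, NeZero (M μ)] (a : ℝ) (ha : 0 < a) {c : ℝ} {e : ι → Matrix n n ℂ}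

include ha in
/-- **RATE END, PRINT'S CURRENCY THROUGHOUT.** `DeltaPrimeSecondOrder.principalB9_deltaPrime_rate_of_regular` with the three `BoundedBackgroundM` binders of the
`Δ′` field towers REPLACED by data hypotheses in the shapes of [B9] (3.35)–(3.36) and node NE3: `‖V_k − 1‖ ≤ α₁/L^k` (size of the bond variables), and for each
of the two plaquette fields `S_k = symF(c_k²(Re U_k(∂p) − 1))`, `B_k = brkF(c_k² Im U_k(∂p))`: size `≤ b`, block-parent consistency `σ/L^k`, lattice-Lipschitz
`σ′/L^k`; the mixed-shift `ShiftLaws` binder is DISCHARGED (`NE2BalabanHodgeShift.shiftLaws_mixedShift`, `cm = 2Cst`).  Conclusion: the tower-limit rate `L^{−k}` for the inverse of print's (3.26) principal part at `R = Ad V` + free averaging + the model's averaging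
perturbation + the whole (3.10) `Δ′`.  Model level: `V` is DATA; that Bałaban's minimiser `U_k` satisfies these hypotheses is node NE3 (OPEN) + (3.35)–(3.36);
the averaging term is the model's, not [B7]'s (residual r2); NE2 (U1a) NOT proved by this. [cite: Balaban1985BackgroundPropagators, (3.10) p.392, (3.26) p.395,
(3.35)–(3.36) p.397 (shapes)] [folklore] -/
theorem principalB9_deltaPrime_rate_of_small [Nonempty n] [Nonempty ι] {Pc : Submodule ℝ (Matrix n n ℂ)} (hF : CompFamily c Pc e) (hL : 2 ≤ L) (hd : 1 ≤ d)
    (V : (k : ℕ) → Fin d → Tor (fine (lev L k) M) → Matrix.unitaryGroup n ℂ)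
    {α β β₂ : ℝ} (hreg₂ : RegularSites L M (fun k ν x => adRep hF (V k ν x)) α β β₂) {C : ℝ} (hC : 0 ≤ C)
    (hNE3₂ : LocalRate (bgReadings L M (regClass₂ L M (fun k ν x => adRep hF (V k ν x)))) C ((L : ℝ)⁻¹)) {a' : ℝ} (ha' : 0 < a')
    {η : ℝ} (hαη : α ≤ η) (hβη : β ≤ η) (hη : η ≤ etaStar ι d a a')
    {α₁ bS σS σS' bB σB σB' : ℝ} (hα₁ : 0 ≤ α₁) (hbS : 0 ≤ bS) (hσS : 0 ≤ σS) (hσS' : 0 ≤ σS') (hbB : 0 ≤ bB) (hσB : 0 ≤ σB) (hσB' : 0 ≤ σB')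
    (hV1 : ∀ k μ x, ‖(V k μ x : Matrix n n ℂ) - 1‖ ≤ α₁ / (lev L k : ℕ))
    (hSb : ∀ k μ ν x, ‖Sfield (fine (lev L k) M) (lev L k) c e (fun ν x => (V k ν x : Matrix n n ℂ)) μ ν x‖ ≤ bS)
    (hSc : ∀ k μ ν (y : Tor (fine (lev L (k + 1)) M)), ‖Sfield (fine (lev L (k + 1)) M) (lev L (k + 1)) c e (fun ν x => (V (k + 1) ν x : Matrix n n ℂ)) μ ν y
      - Sfield (fine (lev L k) M) (lev L k) c e (fun ν x => (V k ν x : Matrix n n ℂ)) μ ν (par (lev L k) L M y)‖ ≤ σS / (lev L k : ℕ))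
    (hSl : ∀ k μ ν lam (x : Tor (fine (lev L k) M)), ‖Sfield (fine (lev L k) M) (lev L k) c e (fun ν x => (V k ν x : Matrix n n ℂ)) μ ν (x - unitVec _ lam)
      - Sfield (fine (lev L k) M) (lev L k) c e (fun ν x => (V k ν x : Matrix n n ℂ)) μ ν x‖ ≤ σS' / (lev L k : ℕ))
    (hBb : ∀ k μ ν x, ‖Bfield (fine (lev L k) M) (lev L k) c e (fun ν x => (V k ν x : Matrix n n ℂ)) μ ν x‖ ≤ bB)
    (hBc : ∀ k μ ν (y : Tor (fine (lev L (k + 1)) M)), ‖Bfield (fine (lev L (k + 1)) M) (lev L (k + 1)) c e (fun ν x => (V (k + 1) ν x : Matrix n n ℂ)) μ ν y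
      - Bfield (fine (lev L k) M) (lev L k) c e (fun ν x => (V k ν x : Matrix n n ℂ)) μ ν (par (lev L k) L M y)‖ ≤ σB / (lev L k : ℕ))
    (hBl : ∀ k μ ν lam (x : Tor (fine (lev L k) M)), ‖Bfield (fine (lev L k) M) (lev L k) c e (fun ν x => (V k ν x : Matrix n n ℂ)) μ ν (x - unitVec _ lam)
      - Bfield (fine (lev L k) M) (lev L k) c e (fun ν x => (V k ν x : Matrix n n ℂ)) μ ν x‖ ≤ σB' / (lev L k : ℕ))
    (hthr : (kappaBs ι d a α β (a * (epsR ι d α * (2 + epsR ι d α) * Cst d a)) (kappa4F d a a' α β)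
      + (d : ℝ) ^ 2 * ((2 * β + 2 * α ^ 2) * Cst d a)) + kappaDP d a bS bB < 1) :
    TowerLimitRate (fun k => Qlev L M k ⊗ₖ (1 : Matrix ι ι ℂ)) ((L : ℝ) ^ d)
      (fun k => (principalB9 (fine (lev L k) M) ((lev L k : ℕ) : ℂ) (fun ν x => adRep hF (V k ν x))
          (projP (fine (lev L k) M) (Gop L M (fun k ν x => adRep hF (V k ν x)) (QuT L M ι (siteT L M (fun k ν x => adRep hF (V k ν x)))) a' k)
            (QuT L M ι (siteT L M (fun k ν x => adRep hF (V k ν x))) k))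
        + ((a : ℂ) • (QvAdj (lev L k) M * QvOp (lev L k) M)) ⊗ₖ (1 : Matrix ι ι ℂ)
        + avgPert L M a (liftR L M (fun k ν x => adRep hF (V k ν x))) k
        + deltaPrime (fine (lev L k) M) (lev L k) c e (fun ν x => (V k ν x : Matrix n n ℂ)))⁻¹)
      (Cpert ((kappaBs ι d a α β (a * (epsR ι d α * (2 + epsR ι d α) * Cst d a)) (kappa4F d a a' α β)
          + (d : ℝ) ^ 2 * ((2 * β + 2 * α ^ 2) * Cst d a)) + kappaDP d a bS bB) (2 * d * Cst d a) (CJ d a)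
        ((C2Bs ι d L a α β (betaNE3 ι C + β₂)
            (a * C2gram (Cst d a) 1 (epsR ι d α) (2 * d * Cst d a) (CJ d a) (Cst d a)
              (CdeltaR ι d a α (theta0 d α (betaNE3 ι (betaNE3 ι C + β₂)))))
            (C4F ι d L a a' α β (betaNE3 ι C + β₂))
          + (d : ℝ) ^ 2 * (Cst d a * ((2 * β + 2 * α ^ 2) * (2 * Cst d a) + (2 * (betaNE3 ι C + β₂) + 4 * α * (betaNE3 ι C + β)) * Cst d a)))
          + CDP d a bS (bS * (4 * α₁) + (σS + σS') + bS * (4 * α₁)) bB (bB * (4 * α₁) + (σB + σB') + bB * (4 * α₁)))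
        0 1) ((L : ℝ)⁻¹) :=
  principalB9_deltaPrime_rate_of_regular L M a ha hF hL hd V hreg₂ hC hNE3₂ ha' (shiftLaws_mixedShift L M a ha) hαη hβη hη
    (boundedBackgroundM_zS_of_small L M hF V hα₁ hbS hσS hσS' hV1 hSb hSc hSl)
    (boundedBackgroundM_zF_of_small L M hF V hα₁ hbB hσB hσB' hV1 hBb hBc hBl)
    (boundedBackgroundM_zB_of_small L M hF V hα₁ hbB hσB hσB' hV1 hBb hBc hBl) hthr

end Rate

end Summit.QuantumFields.BalabanUV.T4Continuum.NE2.DeltaPrimeData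


end
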